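import Literature.IUT.HodgeArakelov.EtaleThetaDataOfSettingAutActionInner

/-!
# [IUTchII] Prop 1.4 / Cor 1.12 (i) at the genuine data: the Π-intrinsic action of `Aut_top(Π^tp_X̲̲)` on the
# TOP level `H¹(Π^tp_Ÿ̲̲, l·Δ_Θ)` (= `H1 ⊤`), compatible with the limit action and with conjugation

abc-iut cell (WAVE-5 seat abc-iut-w5-d169; holder sub-row «P34i-GENUINE-(P1)» of DAG node IUTchII:Prop3.4(i),
`plan/L6/SUBDAG-IUTchII-Prop-31-33-34.md`; L6-lead §F v1.19s).  S. Mochizuki, *Inter-universal Teichmüller theory II*,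
kurims manuscript (Dec. 2020): Prop. 1.4 p. 27 (`θ(Π) ⊆ H¹(Π_Ÿ(Π), (l·Δ_Θ)(Π))`, `∞θ(Π) ⊆ lim_J …`, "functorial
group-theoretic algorithm"); Cor. 1.12 (i) p. 57.  Claim key `Mochizuki2012` (DISPUTED, D-0012); [EtTh] Cor. 2.18 (i)
p. 60 = FACT-LIST F-0620, BY NAME.

WHY.  `θ(Π)` lives at the TOP level `H1 ⊤ ≅ H¹(Π^tp_Ÿ̲̲, l·Δ_Θ)`, `∞θ(Π)` in the limit; binder (P4) of abc-iut-w5-d169's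
`prop34i_multiradiallyDefined_intrinsic` (stability of `toLim ⊤ '' θ(Π)` and `∞θ(Π)` under the limit action
`autActOfCor218i α`) is, by abc-iut-w4-d030's generic `EtaleThetaData.image_toLim_theta_eq_of_compat` /
`image_thetaInfty_eq_of_compat` (`EtaleThetaDataOfSettingConjStable.lean`), a consequence of the stability of `θ(Π)`
under a TOP-level action compatible with the limit action through `toLim ⊤`.  HERE that top-level action is
CONSTRUCTED for the Π-intrinsic action (data definitions + laws; no `Prop`-valued definition, no named fact):
* `autActH1 α : H¹(Π^tp_Ÿ̲̲ ∩ ⊤, l·Δ_Θ) ≃* H¹(Π^tp_Ÿ̲̲ ∩ ⊤, l·Δ_Θ)` — abc-iut-L6-t1's `h1TopAut` for `(α, rangeAut α)` at the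
  restricted ambient `φ(Π^tp_X̲̲)` (bijective by abc-iut-w5-d072's `h1TopAut_bijective`), conjugated by
  abc-iut-w5-d169's `ContH1Restrict.h1Equiv`; `autActTop α : (coh C).H1 ⊤ ≃+ (coh C).H1 ⊤` its `h1Top`-conjugate;
* `toLim_autActTop` — **`toLim ⊤ ∘ autActTop α = autAct α ∘ toLim ⊤`** (abc-iut-L6-t1's `toLim_h1TopAut` transported);
* `autActTop_h1TopConjEquiv` — equivariance `autActTop α ∘ conj_τ = conj_{α τ} ∘ autActTop α` (abc-iut-L6-t1's
  `autMap_conj` transported);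
* `autActTop_symm_autActTop` / `autActTop_symm_apply` — the action of `α⁻¹` inverts the action of `α`;
* `autActTopOfCor218i` — the same for EVERY `α`, stabilisations from F-0620 at `C.rigidData` (under `hq`).
Nothing here takes a side on [IUTchIII] Cor. 3.12; typed ≠ proved.
-/

noncomputable section

open Topology

namespace Literature.IUT.HodgeArakelov

namespace EtaleThetaDataOfSetting

open Literature.AnabelianGeometry.EtaleTheta (ContH1)
open Literature.AnabelianGeometry.EtaleTheta CohomologySystemOfContH1

variable {p : ℕ} [Fact p.Prime] {D : Literature.AnabelianGeometry.EtaleTheta.ThetaSetting p}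
  {E : D.EtaleThetaData} {l : ℕ} (C : E.DoubleUnderline l) (hq : IsQuotientMap D.toTheta)

/-! ### 1. The top level read at the restricted ambient -/

/-- `H¹(Π^tp_Ÿ̲̲ ∩ ⊤, l·Δ_Θ)` with coefficients read in `φ(Π^tp_X̲̲)`: abc-iut-w5-d169's `ContH1Restrict.h1Equiv` at the top
level of the genuine data. [cite: Mochizuki2012, Prop 1.4 p.27] -/
abbrev topRestrict : ContH1 (phi C) (D.lDeltaTheta l) (PiYdd C ⊓ ⊤) ≃*
    ContH1 (phiR C) ((D.lDeltaTheta l).subgroupOf (phiRange C)) (PiYdd C ⊓ ⊤) :=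
  ContH1Restrict.h1Equiv (phi C) (D.lDeltaTheta l) (phiRange C) (phi_mem_phiRange C) (lDeltaTheta_le_phiRange C)
    (PiYdd C ⊓ ⊤)

/-! ### 2. The top-level action of `α` -/

section Act

variable (α : (Pi C) ≃ₜ* (Pi C)) (hker : ∀ x, x ∈ (phi C).ker ↔ α x ∈ (phi C).ker)
  (hA : ∀ x, x ∈ (D.lDeltaTheta l).comap (phi C) ↔ α x ∈ (D.lDeltaTheta l).comap (phi C))
  (hH : ∀ x, x ∈ PiYdd C ↔ α x ∈ PiYdd C)

/-- abc-iut-L6-t1's top-level transport `h1TopAut` for the pair `(α, rangeAut α)` at the restricted ambient, as a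
multiplicative EQUIVALENCE (bijective by abc-iut-w5-d072's `h1TopAut_bijective`). [cite: Mochizuki2012, Cor 1.12 (i) p.57] -/
def topAutR : ContH1 (phiR C) ((D.lDeltaTheta l).subgroupOf (phiRange C)) (PiYdd C ⊓ ⊤) ≃*
    ContH1 (phiR C) ((D.lDeltaTheta l).subgroupOf (phiRange C)) (PiYdd C ⊓ ⊤) :=
  MulEquiv.ofBijective
    (h1TopAut (phiR C) ((D.lDeltaTheta l).subgroupOf (phiRange C)) (PiYdd C) α (rangeAut C α hker hq)
      (rangeAut_phiR C α hker hq) (fun a ha => (mem_lDeltaTheta_iff_rangeAut C α hker hq hA a).mp ha) hH)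
    (h1TopAut_bijective (phiR C) ((D.lDeltaTheta l).subgroupOf (phiRange C)) (PiYdd C) α (rangeAut C α hker hq)
      (rangeAut_phiR C α hker hq) _ hH (mem_lDeltaTheta_iff_rangeAut C α hker hq hA))

/-- `topAutR` is `h1TopAut` as a function. [cite: Mochizuki2012, Cor 1.12 (i) p.57] -/
theorem topAutR_apply (x : ContH1 (phiR C) ((D.lDeltaTheta l).subgroupOf (phiRange C)) (PiYdd C ⊓ ⊤)) :
    topAutR C hq α hker hA hH x =
      h1TopAut (phiR C) ((D.lDeltaTheta l).subgroupOf (phiRange C)) (PiYdd C) α (rangeAut C α hker hq)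
        (rangeAut_phiR C α hker hq) (fun a ha => (mem_lDeltaTheta_iff_rangeAut C α hker hq hA a).mp ha) hH x := rfl

/-- **The action of `α` on `H¹(Π^tp_Ÿ̲̲ ∩ ⊤, l·Δ_Θ)`** (genuine coefficients): `topAutR α` conjugated by the ambient
restriction. DEFINED. [cite: Mochizuki2012, Cor 1.12 (i) p.57] -/
def autActH1 : ContH1 (phi C) (D.lDeltaTheta l) (PiYdd C ⊓ ⊤) ≃* ContH1 (phi C) (D.lDeltaTheta l) (PiYdd C ⊓ ⊤) :=
  ((topRestrict C).trans (topAutR C hq α hker hA hH)).trans (topRestrict C).symm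

/-- `autActH1` read at the restricted ambient: `topRestrict (autActH1 α x) = h1TopAut (α, rangeAut α) (topRestrict x)`.
[cite: Mochizuki2012, Cor 1.12 (i) p.57] -/
theorem topRestrict_autActH1 (x : ContH1 (phi C) (D.lDeltaTheta l) (PiYdd C ⊓ ⊤)) :
    topRestrict C (autActH1 C hq α hker hA hH x) =
      h1TopAut (phiR C) ((D.lDeltaTheta l).subgroupOf (phiRange C)) (PiYdd C) α (rangeAut C α hker hq)
        (rangeAut_phiR C α hker hq) (fun a ha => (mem_lDeltaTheta_iff_rangeAut C α hker hq hA a).mp ha) hH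
        (topRestrict C x) := by
  unfold autActH1
  rw [MulEquiv.trans_apply, MulEquiv.trans_apply, MulEquiv.apply_symm_apply, topAutR_apply]

/-- **The action of `α` on `(coh C).H1 ⊤`** (`= H¹(Π^tp_Ÿ̲̲ ∩ ⊤, l·Δ_Θ)` up to `h1Top`). DEFINED. [cite: Mochizuki2012, Cor 1.12 (i) p.57] -/
def autActTop : (coh C).H1 ⊤ ≃+ (coh C).H1 ⊤ :=
  ((h1Top C).trans (MulEquiv.toAdditive (autActH1 C hq α hker hA hH))).trans (h1Top C).symm

/-- `autActTop` read through `h1Top`: `autActTop α (h1Top⁻¹ y) = h1Top⁻¹ (autActH1 α y)`. [cite: Mochizuki2012, Cor 1.12 (i) p.57] -/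
theorem autActTop_h1Top_symm (y : Additive (ContH1 (phi C) (D.lDeltaTheta l) (PiYdd C ⊓ ⊤))) :
    autActTop C hq α hker hA hH ((h1Top C).symm y) =
      (h1Top C).symm (Additive.ofMul (autActH1 C hq α hker hA hH (Additive.toMul y))) := by
  unfold autActTop
  rw [AddEquiv.trans_apply, AddEquiv.trans_apply, AddEquiv.apply_symm_apply]
  rfl

/-- The top-level comparison read at the restricted ambient: `limRestrict (toLim ⊤ (h1Top⁻¹ z))` is the colimit
injection (at the index `⊤`) of `topRestrict z`. [cite: Mochizuki2012, Prop 1.4 p.27] -/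
theorem limRestrict_toLim_h1Top_symm (z : Additive (ContH1 (phi C) (D.lDeltaTheta l) (PiYdd C ⊓ ⊤))) :
    limRestrict C ((coh C).toLim ⊤ ((h1Top C).symm z)) =
      h1Of (phiR C) ((D.lDeltaTheta l).subgroupOf (phiRange C)) (PiYdd C) ⊥
        ((Idx.self (P := Pi C) ⊤ inferInstance (by simp)).incl bot_le)
        (ContH1Restrict.gmodEquiv (phi C) (D.lDeltaTheta l) (PiYdd C) (phiRange C) (phi_mem_phiRange C)
          (lDeltaTheta_le_phiRange C) ⊥ ((Idx.self (P := Pi C) ⊤ inferInstance (by simp)).incl bot_le) z) := by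
  have h1 : (coh C).toLim ⊤ ((h1Top C).symm z) =
      h1Of (phi C) (D.lDeltaTheta l) (PiYdd C) ⊥ ((Idx.self (P := Pi C) ⊤ inferInstance (by simp)).incl bot_le) z :=
    toLim_h1Equiv_symm (phi C) (D.lDeltaTheta l) (PiYdd C) ⊤ inferInstance _ z
  exact (congrArg (limRestrict C) h1).trans
    (ContH1Restrict.limEquiv_of (phi C) (D.lDeltaTheta l) (PiYdd C) (phiRange C) (phi_mem_phiRange C)
      (lDeltaTheta_le_phiRange C) ⊥ ((Idx.self (P := Pi C) ⊤ inferInstance (by simp)).incl bot_le) z)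

/-- The member isomorphism at the index `⊤` is `topRestrict` (bookkeeping, `rfl`). [cite: Mochizuki2012, Prop 1.4 p.27] -/
theorem gmodEquiv_top_eq (z : Additive (ContH1 (phi C) (D.lDeltaTheta l) (PiYdd C ⊓ ⊤))) :
    ContH1Restrict.gmodEquiv (phi C) (D.lDeltaTheta l) (PiYdd C) (phiRange C) (phi_mem_phiRange C)
        (lDeltaTheta_le_phiRange C) ⊥ ((Idx.self (P := Pi C) ⊤ inferInstance (by simp)).incl bot_le) z =
      Additive.ofMul (topRestrict C (Additive.toMul z)) := rfl

/-- **Compatibility with the limit action: `toLim ⊤ ∘ autActTop α = autAct α ∘ toLim ⊤`** (abc-iut-L6-t1's square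
`toLim_h1TopAut` at the restricted ambient, transported by `ContH1Restrict.limEquiv` / `h1Equiv`).
[cite: Mochizuki2012, Cor 1.12 (i) p.57] -/
theorem toLim_autActTop (x : (coh C).H1 ⊤) :
    (coh C).toLim ⊤ (autActTop C hq α hker hA hH x) = autAct C hq α hker hA hH ((coh C).toLim ⊤ x) := by
  obtain ⟨y, rfl⟩ : ∃ y, x = (h1Top C).symm y := ⟨h1Top C x, ((h1Top C).symm_apply_apply x).symm⟩
  apply (limRestrict C).injective
  rw [limRestrict_autAct, autActTop_h1Top_symm, limRestrict_toLim_h1Top_symm, limRestrict_toLim_h1Top_symm,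
    gmodEquiv_top_eq, gmodEquiv_top_eq]
  -- abc-iut-L6-t1's square at the restricted ambient, read on the colimit injections at the index `⊤`
  have key := toLim_h1TopAut (phiR C) ((D.lDeltaTheta l).subgroupOf (phiRange C)) (PiYdd C) α (rangeAut C α hker hq)
    (rangeAut_phiR C α hker hq) (fun a ha => (mem_lDeltaTheta_iff_rangeAut C α hker hq hA a).mp ha) hH
    (Additive.ofMul (topRestrict C (Additive.toMul y)))
  have k1 := toLim_h1Equiv_symm (phiR C) ((D.lDeltaTheta l).subgroupOf (phiRange C)) (PiYdd C) ⊤ inferInstance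
    (by simp) (MonoidHom.toAdditive (h1TopAut (phiR C) ((D.lDeltaTheta l).subgroupOf (phiRange C)) (PiYdd C) α
      (rangeAut C α hker hq) (rangeAut_phiR C α hker hq)
      (fun a ha => (mem_lDeltaTheta_iff_rangeAut C α hker hq hA a).mp ha) hH)
      (Additive.ofMul (topRestrict C (Additive.toMul y))))
  have k2 := toLim_h1Equiv_symm (phiR C) ((D.lDeltaTheta l).subgroupOf (phiRange C)) (PiYdd C) ⊤ inferInstance
    (by simp) (Additive.ofMul (topRestrict C (Additive.toMul y)))
  have h1 : Additive.ofMul (topRestrict C (Additive.toMul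
        (Additive.ofMul (autActH1 C hq α hker hA hH (Additive.toMul y))))) =
      MonoidHom.toAdditive (h1TopAut (phiR C) ((D.lDeltaTheta l).subgroupOf (phiRange C)) (PiYdd C) α
        (rangeAut C α hker hq) (rangeAut_phiR C α hker hq)
        (fun a ha => (mem_lDeltaTheta_iff_rangeAut C α hker hq hA a).mp ha) hH)
        (Additive.ofMul (topRestrict C (Additive.toMul y))) :=
    congrArg Additive.ofMul (topRestrict_autActH1 C hq α hker hA hH (Additive.toMul y))
  exact (congrArg (h1Of (phiR C) ((D.lDeltaTheta l).subgroupOf (phiRange C)) (PiYdd C) ⊥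
      ((Idx.self (P := Pi C) ⊤ inferInstance (by simp)).incl bot_le)) h1).trans
    (k1.symm.trans (key.trans (congrArg _ k2)))

/-- **Equivariance at the top level**: `autActTop α ∘ conj_τ = conj_{α τ} ∘ autActTop α` (`Π^tp_Ÿ̲̲` normal).
[cite: Mochizuki2012, Prop 3.4 (i) p.91] -/
theorem autActH1_conj [(PiYdd C).Normal] (τ : Pi C) (m : ContH1 (phi C) (D.lDeltaTheta l) (PiYdd C ⊓ ⊤)) :
    autActH1 C hq α hker hA hH (ContH1.conj (phi C) (D.lDeltaTheta l) τ m) =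
      ContH1.conj (phi C) (D.lDeltaTheta l) (α τ) (autActH1 C hq α hker hA hH m) := by
  apply (topRestrict C).injective
  rw [topRestrict_autActH1, ContH1Restrict.h1Equiv_conj, ContH1Restrict.h1Equiv_conj, topRestrict_autActH1]
  exact ContH1Aut.autMap_conj (phiR C) ((D.lDeltaTheta l).subgroupOf (phiRange C)) α (rangeAut C α hker hq)
    (rangeAut_phiR C α hker hq) _ _ τ _

/-- The same on `(coh C).H1 ⊤` with abc-iut-w4-d043's `h1TopConjEquiv`. [cite: Mochizuki2012, Prop 3.4 (i) p.91] -/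
theorem autActTop_h1TopConjEquiv [(PiYdd C).Normal] (τ : Pi C) (x : (coh C).H1 ⊤) :
    autActTop C hq α hker hA hH (h1TopConjEquiv (phi C) (D.lDeltaTheta l) (PiYdd C) τ x) =
      h1TopConjEquiv (phi C) (D.lDeltaTheta l) (PiYdd C) (α τ) (autActTop C hq α hker hA hH x) := by
  obtain ⟨y, rfl⟩ : ∃ y, x = (h1Top C).symm y := ⟨h1Top C x, ((h1Top C).symm_apply_apply x).symm⟩
  have e1 := h1TopConjEquiv_symm_apply (phi C) (D.lDeltaTheta l) (PiYdd C) τ y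
  have e2 := h1TopConjEquiv_symm_apply (phi C) (D.lDeltaTheta l) (PiYdd C) (α τ)
    (Additive.ofMul (autActH1 C hq α hker hA hH (Additive.toMul y)))
  change autActTop C hq α hker hA hH (h1TopConjEquiv (phi C) (D.lDeltaTheta l) (PiYdd C) τ ((h1Top C).symm y)) =
    h1TopConjEquiv (phi C) (D.lDeltaTheta l) (PiYdd C) (α τ) (autActTop C hq α hker hA hH ((h1Top C).symm y))
  rw [autActTop_h1Top_symm]
  change autActTop C hq α hker hA hH
      (h1TopConjEquiv (phi C) (D.lDeltaTheta l) (PiYdd C) τ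
        ((h1EquivOfFiniteIndexOpen (phi C) (D.lDeltaTheta l) (PiYdd C) ⊤ inferInstance (by simp)).symm y)) =
    h1TopConjEquiv (phi C) (D.lDeltaTheta l) (PiYdd C) (α τ)
      ((h1EquivOfFiniteIndexOpen (phi C) (D.lDeltaTheta l) (PiYdd C) ⊤ inferInstance (by simp)).symm
        (Additive.ofMul (autActH1 C hq α hker hA hH (Additive.toMul y))))
  rw [e1, e2]
  change autActTop C hq α hker hA hH ((h1Top C).symm _) = (h1Top C).symm _
  rw [autActTop_h1Top_symm]
  congr 1
  exact congrArg Additive.ofMul (autActH1_conj C hq α hker hA hH τ (Additive.toMul y))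

end Act

/-! ### 3. The action of `α⁻¹` inverts the action of `α` -/

section Symm

variable (α : (Pi C) ≃ₜ* (Pi C)) (hker : ∀ x, x ∈ (phi C).ker ↔ α x ∈ (phi C).ker)
  (hA : ∀ x, x ∈ (D.lDeltaTheta l).comap (phi C) ↔ α x ∈ (D.lDeltaTheta l).comap (phi C))
  (hH : ∀ x, x ∈ PiYdd C ↔ α x ∈ PiYdd C)
  (hker' : ∀ x, x ∈ (phi C).ker ↔ α.symm x ∈ (phi C).ker)
  (hA' : ∀ x, x ∈ (D.lDeltaTheta l).comap (phi C) ↔ α.symm x ∈ (D.lDeltaTheta l).comap (phi C))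
  (hH' : ∀ x, x ∈ PiYdd C ↔ α.symm x ∈ PiYdd C)

/-- `autActH1 α⁻¹ (autActH1 α m) = m` (abc-iut-w5-d072's `h1TopAut_symm_h1TopAut` at the restricted ambient).
[cite: Mochizuki2012, Cor 1.12 (i) p.57] -/
theorem autActH1_symm_autActH1 (m : ContH1 (phi C) (D.lDeltaTheta l) (PiYdd C ⊓ ⊤)) :
    autActH1 C hq α.symm hker' hA' hH' (autActH1 C hq α hker hA hH m) = m := by
  apply (topRestrict C).injective
  rw [topRestrict_autActH1, topRestrict_autActH1]
  exact h1TopAut_symm_h1TopAut (phiR C) ((D.lDeltaTheta l).subgroupOf (phiRange C)) (PiYdd C) α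
    (rangeAut C α hker hq) (rangeAut_phiR C α hker hq) _ hH (mem_lDeltaTheta_iff_rangeAut C α hker hq hA) _

/-- `autActTop α⁻¹ (autActTop α x) = x`. [cite: Mochizuki2012, Cor 1.12 (i) p.57] -/
theorem autActTop_symm_autActTop (x : (coh C).H1 ⊤) :
    autActTop C hq α.symm hker' hA' hH' (autActTop C hq α hker hA hH x) = x := by
  obtain ⟨y, rfl⟩ : ∃ y, x = (h1Top C).symm y := ⟨h1Top C x, ((h1Top C).symm_apply_apply x).symm⟩
  rw [autActTop_h1Top_symm, autActTop_h1Top_symm]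
  congr 1
  exact congrArg Additive.ofMul (autActH1_symm_autActH1 C hq α hker hA hH hker' hA' hH' (Additive.toMul y))

end Symm

/-- **The inverse of `autActTop α` is `autActTop α⁻¹`.** [cite: Mochizuki2012, Cor 1.12 (i) p.57] -/
theorem autActTop_symm_apply (α : (Pi C) ≃ₜ* (Pi C)) (hker : ∀ x, x ∈ (phi C).ker ↔ α x ∈ (phi C).ker)
    (hA : ∀ x, x ∈ (D.lDeltaTheta l).comap (phi C) ↔ α x ∈ (D.lDeltaTheta l).comap (phi C))
    (hH : ∀ x, x ∈ PiYdd C ↔ α x ∈ PiYdd C)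
    (hker' : ∀ x, x ∈ (phi C).ker ↔ α.symm x ∈ (phi C).ker)
    (hA' : ∀ x, x ∈ (D.lDeltaTheta l).comap (phi C) ↔ α.symm x ∈ (D.lDeltaTheta l).comap (phi C))
    (hH' : ∀ x, x ∈ PiYdd C ↔ α.symm x ∈ PiYdd C) (x : (coh C).H1 ⊤) :
    (autActTop C hq α hker hA hH).symm x = autActTop C hq α.symm hker' hA' hH' x := by
  apply (autActTop C hq α hker hA hH).injective
  rw [AddEquiv.apply_symm_apply]
  exact (autActTop_symm_autActTop C hq α.symm hker' hA' hH' hker hA hH x).symm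

/-! ### 4. For EVERY `α`, from [EtTh] Cor 2.18 (i) (F-0620) -/

section FromCor218i

variable {N : ℕ+} (μ : D.CyclotomeMod l N)

/-- **`autActTop` for EVERY topological automorphism of `Π^tp_X̲̲`**, the stabilisations being the F-0620 clauses at
`C.rigidData`. DEFINED. [cite: MochizukiEtTh2009, Cor 2.18 (i) p.60] -/
def autActTopOfCor218i (hC : D.Compat) (hS : D.Sec2Hyps) (h15 : D.Prop15iii E hC) (L : C.CuspLabels)
    (R : RigidData.{0} N l) (hR : R = C.rigidData μ hC hS h15 L) (h218i : R.Cor218_i) (α : (Pi C) ≃ₜ* (Pi C)) :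
    (coh C).H1 ⊤ ≃+ (coh C).H1 ⊤ :=
  autActTop C hq α (mem_ker_phi_iff_of_cor218_i C μ hC hS h15 L R hR h218i α)
    (mem_comap_lDeltaTheta_iff_of_cor218_i C μ hC hS h15 L R hR h218i α)
    (mem_PiYdd_iff_of_cor218_i C μ hC hS h15 L R hR h218i α)

/-- Compatibility with the limit action `autActOfCor218i`. [cite: Mochizuki2012, Cor 1.12 (i) p.57] -/
theorem toLim_autActTopOfCor218i (hC : D.Compat) (hS : D.Sec2Hyps) (h15 : D.Prop15iii E hC) (L : C.CuspLabels)
    (R : RigidData.{0} N l) (hR : R = C.rigidData μ hC hS h15 L) (h218i : R.Cor218_i) (α : (Pi C) ≃ₜ* (Pi C))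
    (x : (coh C).H1 ⊤) :
    (coh C).toLim ⊤ (autActTopOfCor218i C hq μ hC hS h15 L R hR h218i α x) =
      autActOfCor218i C hq μ hC hS h15 L R hR h218i α ((coh C).toLim ⊤ x) :=
  toLim_autActTop C hq α _ _ _ x

/-- Equivariance with abc-iut-w4-d043's `h1TopConjEquiv`. [cite: Mochizuki2012, Prop 3.4 (i) p.91] -/
theorem autActTopOfCor218i_h1TopConjEquiv [(PiYdd C).Normal] (hC : D.Compat) (hS : D.Sec2Hyps)
    (h15 : D.Prop15iii E hC) (L : C.CuspLabels) (R : RigidData.{0} N l) (hR : R = C.rigidData μ hC hS h15 L)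
    (h218i : R.Cor218_i) (α : (Pi C) ≃ₜ* (Pi C)) (τ : Pi C) (x : (coh C).H1 ⊤) :
    autActTopOfCor218i C hq μ hC hS h15 L R hR h218i α (h1TopConjEquiv (phi C) (D.lDeltaTheta l) (PiYdd C) τ x) =
      h1TopConjEquiv (phi C) (D.lDeltaTheta l) (PiYdd C) (α τ) (autActTopOfCor218i C hq μ hC hS h15 L R hR h218i α x) :=
  autActTop_h1TopConjEquiv C hq α _ _ _ τ x

/-- The inverse of `autActTopOfCor218i α` is `autActTopOfCor218i α⁻¹`. [cite: Mochizuki2012, Cor 1.12 (i) p.57] -/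
theorem autActTopOfCor218i_symm_apply (hC : D.Compat) (hS : D.Sec2Hyps) (h15 : D.Prop15iii E hC)
    (L : C.CuspLabels) (R : RigidData.{0} N l) (hR : R = C.rigidData μ hC hS h15 L) (h218i : R.Cor218_i)
    (α : (Pi C) ≃ₜ* (Pi C)) (x : (coh C).H1 ⊤) :
    (autActTopOfCor218i C hq μ hC hS h15 L R hR h218i α).symm x =
      autActTopOfCor218i C hq μ hC hS h15 L R hR h218i α.symm x :=
  autActTop_symm_apply C hq α _ _ _ _ _ _ x

end FromCor218i

end EtaleThetaDataOfSetting

end Literature.IUT.HodgeArakelov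

end
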